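import Literature.NumberTheory.Automorphic.BrandtDefiniteSetupLite
import Literature.NumberTheory.Automorphic.BrandtHeckeFamily
import Literature.NumberTheory.Automorphic.BrandtModuleSplitLocal
import Literature.NumberTheory.Automorphic.QuaternionAlgebraSplitting
import HarnessLib

/-!
# The definite Brandt set-up `Brandt.DefiniteSetupLite`: dictionary to the tree's `ℤ`-orders,
# invertible right ideals, residual splitting and sub-ideals

Topic `Literature/NumberTheory/Automorphic`; theorems only (no definition, no named fact, no
instance; D-0026). `BrandtDefiniteSetupLite.lean` packages the INLINE definite Brandt set-up of the
routes `VerticalContact` / `VerticalSelmerBound` (`a, b < 0`, `B = (a,b)_ℚ` ramified exactly at the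
primes of the squarefree `N⁻` in the sense of `IsRamifiedExactlyAtLite` — a statement about Mathlib's
`ℍ[ℚ_q, a, b]` —, an Eichler order `S.O : Subring B` of level `N⁺` in the sense of
`IsEichlerOrderLite`, the invertible right ideals `rightIdealsLite`, the Hecke neighbours
`heckeNeighboursLite`) and deliberately does not bridge it to the tree's Brandt-module library
(`BrandtModule*.lean`: `IsZOrder`, `IsEichlerOrder`, `IsInvertibleRightIdeal`, `Subideal`,
`IsZOrder.IsResiduallySplit`, …). This file is that bridge — every statement a reformulation or a
direct consequence of a tree theorem, cited to the same sources:

* `Brandt.isZOrder_subringLattice`, `Brandt.DefiniteSetupLite.isZOrder` — the lattice of a finitely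
  generated full subring (in particular `S.O`) is a `ℤ`-order (Vignéras I §4 Déf.).
* `Brandt.mem_rightIdealsLite_iff_isInvertibleRightIdeal` —
  **`rightIdealsLite O = invertibleRightIdeals (subringLattice O)`** (the inline clauses are the
  fields of `IsInvertibleRightIdeal`, read through `x ∈ subringLattice O ↔ x ∈ O`).
* `Brandt.isMaximalZOrder_subringLattice`, `Brandt.DefiniteSetupLite.isEichlerOrder` — the inline
  maximal / Eichler orders are the tree's (Vignéras I §4 Déf. p. 20).
* `Brandt.DefiniteSetupLite.isQuaternionAlgebra`, `Brandt.forall_isUnit_of_neg`,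
  `Brandt.DefiniteSetupLite.forall_isUnit` — `(a,b)_ℚ` is a quaternion algebra, and a DIVISION
  algebra for `a, b < 0` (the norm form `x² - a y² - b z² + a b w²` is anisotropic; Vignéras I §1
  Lemme 1.1).
* `Brandt.DefiniteSetupLite.nonempty_algEquiv_padic` — **`ℚ_q ⊗ B ≃ M₂(ℚ_q)` for `q ∤ N⁻`**: by
  `IsRamifiedExactlyAtLite` the algebra `ℍ[ℚ_q, a, b]` is not a division algebra, hence a matrix
  algebra (Vignéras I §2 Cor. 2.4, `QuaternionAlgebra.nonempty_algEquiv_matrix_iff` with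
  `exists_sq_sub_mul_sq_of_not_isUnit`), and `ℚ_q ⊗ ℍ[ℚ,a,b] ≃ ℍ[ℚ_q,a,b]`
  (`QuaternionAlgebra.nonempty_baseChange_algEquiv`).
* `Brandt.DefiniteSetupLite.isResiduallySplit` — **`S.O` is residually split at every prime
  `q ∤ N⁺N⁻`** (as `XiSetup.isResiduallySplit`: Eichler's count `q + 1` of sub-ideals of index `q²`
  against the dichotomy split/ramified; Vignéras II §2 Thm. 2.3, Eichler 1973 II §6 (16)).
* `Brandt.DefiniteSetupLite.finite_rightIdealClass` — the class set of `S.O` is finite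
  (Jordan–Zassenhaus, `RightIdealClass.finite`; Vignéras III §5 Thm. 5.4).
* `Brandt.map_mulLeft_eq_units_smul` — the routes' left translate `I.map (x ↦ β x)` is the tree's
  `β • I`.
* `Brandt.DefiniteSetupLite.mem_heckeNeighboursLite_iff` — **for a prime `q ∤ N⁺N⁻` and an
  invertible right ideal `I`, the Hecke neighbours of `I` (right-`O`-stable sublattices of index
  `q²`) are exactly the invertible right `O`-ideals `J ⊆ I` of index `q²`**, i.e. the tree's
  `Subideal (subringLattice S.O) I q` (heredity at a residually split prime,
  `IsMatrixUnitsMod.isInvertibleRightIdeal_of_between`; Vignéras II §2).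

## References

* [VignerasLNM800] M.-F. Vignéras, LNM 800 (1980), Ch. I §1 Lemme 1.1, §2 Cor. 2.4, §4 Déf. p. 20;
  Ch. II §2 Thm. 2.3; Ch. III §5 Thm. 5.4.
* [Eichler1973] M. Eichler, LNM 320 (1973), Ch. II §6 (16).
* [Voight2021] J. Voight, GTM 288 (2021), Def. 16.5.1, Main Thm. 16.6.1, Def. 17.3.4, Def. 23.4.1.
-/

noncomputable section

open scoped TensorProduct Pointwise

namespace Literature.NumberTheory.Automorphic

namespace Brandt

variable {a b : ℚ}

/-! ### The order of the set-up is a `ℤ`-order; right ideals -/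

/-- The additive group of `subringLattice O` is that of `O`. [folklore] -/
theorem toAddSubgroup_subringLattice (O : Subring (QuaternionAlgebra ℚ a 0 b)) :
    (subringLattice O).toAddSubgroup = O.toAddSubgroup := by
  rw [subringLattice, AddSubgroup.toIntSubmodule_toAddSubgroup]

/-- **A finitely generated full subring of `B` is, as a lattice, a `ℤ`-order** in the tree's
sense (`IsZOrder`: contains `1`, closed under products, full lattice).
[cite: VignerasLNM800, Ch. I §4 Déf. p. 20 (ordre)] -/
theorem isZOrder_subringLattice (O : Subring (QuaternionAlgebra ℚ a 0 b))
    (hfg : O.toAddSubgroup.FG)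
    (hfull : ∀ d : QuaternionAlgebra ℚ a 0 b, ∃ n : ℤ, n ≠ 0 ∧ n • d ∈ O) :
    IsZOrder (subringLattice O) where
  one_mem := mem_subringLattice.mpr O.one_mem
  mul_mem x hx y hy := mem_subringLattice.mpr
    (O.mul_mem (mem_subringLattice.mp hx) (mem_subringLattice.mp hy))
  isFullLattice := by
    refine ⟨?_, fun d => ?_⟩
    · rw [Submodule.fg_iff_addSubgroup_fg, toAddSubgroup_subringLattice]
      exact hfg
    · obtain ⟨n, hn, hnd⟩ := hfull d
      exact ⟨n, hn, mem_subringLattice.mpr hnd⟩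

/-- The order `S.O` of a definite set-up is a `ℤ`-order (as the lattice `subringLattice S.O`).
[cite: VignerasLNM800, Ch. I §4 Déf. p. 20 (ordre)] -/
theorem DefiniteSetupLite.isZOrder {Nplus Nminus : ℕ} (S : DefiniteSetupLite Nplus Nminus) :
    IsZOrder (subringLattice S.O) :=
  isZOrder_subringLattice S.O S.O_fg S.O_full

/-- The lattice `subringLattice O` of a subring as a set is `O`. [folklore] -/
theorem coe_subringLattice (O : Subring (QuaternionAlgebra ℚ a 0 b)) :
    ((subringLattice O : Submodule ℤ (QuaternionAlgebra ℚ a 0 b)) :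
      Set (QuaternionAlgebra ℚ a 0 b)) = O := by
  ext x
  exact mem_subringLattice

/-- **The inline invertible right ideals are the tree's**:
`J ∈ rightIdealsLite O ↔ IsInvertibleRightIdeal (subringLattice O) J` — the four inline clauses
(finitely generated full lattice, right order exactly `O`, a lattice `J'` with `J J' = O_ℓ(J)` and
`J' J = O`) are the fields of `IsInvertibleRightIdeal`. [cite: Voight2021, Def. 16.5.1]
[cite: VignerasLNM800, Ch. I §4 pp. 20–21] -/
theorem mem_rightIdealsLite_iff_isInvertibleRightIdeal (O : Subring (QuaternionAlgebra ℚ a 0 b))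
    (J : Submodule ℤ (QuaternionAlgebra ℚ a 0 b)) :
    J ∈ rightIdealsLite O ↔ IsInvertibleRightIdeal (subringLattice O) J := by
  constructor
  · rintro ⟨hfg, hfull, hright, J', hJJ', hJ'J⟩
    refine ⟨⟨hfg, hfull⟩, ?_, J', ?_, ?_⟩
    · ext x
      rw [mem_rightOrderOf_iff, mem_subringLattice]
      exact hright x
    · ext x
      rw [mem_leftOrderOf_iff]
      exact hJJ' x
    · ext x
      rw [mem_subringLattice]
      exact hJ'J x
  · rintro ⟨⟨hfg, hfull⟩, hright, J', hJJ', hJ'J⟩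
    refine ⟨hfg, hfull, fun x => ?_, J', fun x => ?_, fun x => ?_⟩
    · rw [← mem_subringLattice (O := O), ← hright, mem_rightOrderOf_iff]
    · rw [hJJ', mem_leftOrderOf_iff]
    · rw [hJ'J, mem_subringLattice]

/-- `rightIdealsLite O = invertibleRightIdeals (subringLattice O)` as sets. [folklore] -/
theorem rightIdealsLite_eq_invertibleRightIdeals (O : Subring (QuaternionAlgebra ℚ a 0 b)) :
    rightIdealsLite O = invertibleRightIdeals (subringLattice O) :=
  Set.ext fun J => mem_rightIdealsLite_iff_isInvertibleRightIdeal O J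

/-! ### Maximal and Eichler orders -/

/-- **An inline maximal order is a maximal `ℤ`-order of the tree** (maximal among finitely
generated subrings ⇒ maximal among `ℤ`-orders: a `ℤ`-order containing `O` is the lattice of a
finitely generated subring containing `O`). [cite: VignerasLNM800, Ch. I §4 Déf. p. 20 (ordre maximal)] -/
theorem isMaximalZOrder_subringLattice {O : Subring (QuaternionAlgebra ℚ a 0 b)}
    (h : IsMaximalOrderLite O) : IsMaximalZOrder (subringLattice O) := by
  refine ⟨isZOrder_subringLattice O h.1 h.2.1, fun O' hO' hle => ?_⟩
  -- the subring with lattice `O'`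
  let T : Subring (QuaternionAlgebra ℚ a 0 b) :=
    { carrier := O'
      mul_mem' := fun {x y} hx hy => hO'.mul_mem x hx y hy
      one_mem' := hO'.one_mem
      add_mem' := fun {x y} hx hy => O'.add_mem hx hy
      zero_mem' := O'.zero_mem
      neg_mem' := fun {x} hx => O'.neg_mem hx }
  have hTO' : ∀ x, x ∈ T ↔ x ∈ O' := fun _ => Iff.rfl
  have hTfg : T.toAddSubgroup.FG := by
    have : T.toAddSubgroup = O'.toAddSubgroup := AddSubgroup.ext fun _ => Iff.rfl
    rw [this, ← Submodule.fg_iff_addSubgroup_fg]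
    exact hO'.isFullLattice.1
  have hOT : O ≤ T := fun x hx => (hTO' x).mpr (hle (mem_subringLattice.mpr hx))
  have hT : T = O := h.2.2 T hTfg hOT
  ext x
  rw [mem_subringLattice, ← hT, hTO']

/-- `subringLattice` turns intersections of subrings into intersections of lattices. [folklore] -/
theorem subringLattice_inf (O₁ O₂ : Subring (QuaternionAlgebra ℚ a 0 b)) :
    subringLattice (O₁ ⊓ O₂) = subringLattice O₁ ⊓ subringLattice O₂ := by
  ext x
  simp only [mem_subringLattice, Subring.mem_inf, Submodule.mem_inf]

/-- **The Eichler order of a definite set-up is an Eichler order of level `N⁺` of the tree**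
(`IsEichlerOrder (subringLattice S.O) N⁺`: intersection of two maximal `ℤ`-orders, of index `N⁺`
in the first). [cite: VignerasLNM800, Ch. I §4 Déf. p. 20] [cite: Voight2021, Def. 23.4.1] -/
theorem DefiniteSetupLite.isEichlerOrder {Nplus Nminus : ℕ} (S : DefiniteSetupLite Nplus Nminus) :
    _root_.Literature.NumberTheory.Automorphic.IsEichlerOrder (subringLattice S.O) Nplus := by
  obtain ⟨O₁, O₂, hmax, hO, hidx⟩ := S.eichler
  refine ⟨subringLattice O₁, subringLattice O₂, isMaximalZOrder_subringLattice (hmax O₁ (Or.inl rfl)),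
    isMaximalZOrder_subringLattice (hmax O₂ (Or.inr rfl)), ?_, ?_⟩
  · rw [← subringLattice_inf, ← hO]
  · rw [toAddSubgroup_subringLattice, toAddSubgroup_subringLattice]
    exact hidx

/-! ### The algebra: quaternion, division, split away from `N⁻` -/

/-- `(a,b)_ℚ` with `a b ≠ 0` is a quaternion algebra over `ℚ` in the tree's sense
(`IsQuaternionAlgebra`; `QuaternionAlgebra.isQuaternionAlgebra_holds`). [cite: VignerasLNM800, Ch. I §1 p. 2] -/
theorem isQuaternionAlgebra_of_ne_zero (ha : a ≠ 0) (hb : b ≠ 0) :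
    IsQuaternionAlgebra ℚ (QuaternionAlgebra ℚ a 0 b) :=
  QuaternionAlgebra.isQuaternionAlgebra_holds ha hb

/-- The algebra of a definite set-up is a quaternion algebra over `ℚ`. [cite: VignerasLNM800, Ch. I §1 p. 2] -/
theorem DefiniteSetupLite.isQuaternionAlgebra {Nplus Nminus : ℕ} (S : DefiniteSetupLite Nplus Nminus) :
    IsQuaternionAlgebra ℚ (QuaternionAlgebra ℚ S.a 0 S.b) :=
  isQuaternionAlgebra_of_ne_zero S.a_neg.ne S.b_neg.ne

/-- **`(a,b)_ℚ` is a division algebra for `a, b < 0`**: the reduced norm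
`x² - a y² - b z² + a b w²` of a non-zero element is a sum of non-negative terms, not all zero,
hence non-zero, and an element of non-zero reduced norm is a unit (Vignéras I §1 Lemme 1.1).
[cite: VignerasLNM800, Ch. I §1 Lemme 1.1] -/
theorem forall_isUnit_of_neg (ha : a < 0) (hb : b < 0) :
    ∀ x : QuaternionAlgebra ℚ a 0 b, x ≠ 0 → IsUnit x := by
  intro x hx
  refine QuaternionAlgebra.isUnit_of_normForm_ne_zero x ?_
  have hab : 0 < a * b := mul_pos_of_neg_of_neg ha hb
  have h1 : 0 ≤ x.re ^ 2 := sq_nonneg _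
  have h2 : 0 ≤ -a * x.imI ^ 2 := mul_nonneg (neg_nonneg.mpr ha.le) (sq_nonneg _)
  have h3 : 0 ≤ -b * x.imJ ^ 2 := mul_nonneg (neg_nonneg.mpr hb.le) (sq_nonneg _)
  have h4 : 0 ≤ a * b * x.imK ^ 2 := mul_nonneg hab.le (sq_nonneg _)
  intro h0
  have hsum : x.re ^ 2 + -a * x.imI ^ 2 + -b * x.imJ ^ 2 + a * b * x.imK ^ 2 = 0 := by
    linear_combination h0
  have e1 : x.re ^ 2 = 0 := by linarith
  have e2 : -a * x.imI ^ 2 = 0 := by linarith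
  have e3 : -b * x.imJ ^ 2 = 0 := by linarith
  have e4 : a * b * x.imK ^ 2 = 0 := by linarith
  have hre : x.re = 0 := by simpa using e1
  have hI : x.imI = 0 := by
    rcases mul_eq_zero.mp e2 with h | h
    · exact absurd h (neg_ne_zero.mpr ha.ne)
    · simpa using h
  have hJ : x.imJ = 0 := by
    rcases mul_eq_zero.mp e3 with h | h
    · exact absurd h (neg_ne_zero.mpr hb.ne)
    · simpa using h
  have hK : x.imK = 0 := by
    rcases mul_eq_zero.mp e4 with h | h
    · exact absurd h hab.ne'
    · simpa using h
  exact hx (QuaternionAlgebra.ext hre hI hJ hK)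

/-- The algebra of a definite set-up is a division algebra. [cite: VignerasLNM800, Ch. I §1 Lemme 1.1] -/
theorem DefiniteSetupLite.forall_isUnit {Nplus Nminus : ℕ} (S : DefiniteSetupLite Nplus Nminus) :
    ∀ x : QuaternionAlgebra ℚ S.a 0 S.b, x ≠ 0 → IsUnit x :=
  forall_isUnit_of_neg S.a_neg S.b_neg

/-- **The algebra of a definite set-up of type `(N⁺, N⁻)` splits at every prime `q ∤ N⁻`** over
Mathlib's `ℚ_[q]`: `ℚ_q ⊗ B ≃ M₂(ℚ_q)`. By `IsRamifiedExactlyAtLite`, `ℍ[ℚ_q, a, b]` has a non-zero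
non-unit, so `b = x² - a y²` is solvable in `ℚ_q` and `ℍ[ℚ_q, a, b] ≃ M₂(ℚ_q)` (Vignéras I §2
Cor. 2.4); compose with the base change `ℚ_q ⊗ ℍ[ℚ,a,b] ≃ ℍ[ℚ_q,a,b]`.
[cite: VignerasLNM800, Ch. I §2 Cor. 2.4] -/
theorem DefiniteSetupLite.nonempty_algEquiv_padic {Nplus Nminus : ℕ}
    (S : DefiniteSetupLite Nplus Nminus) {q : ℕ} [Fact q.Prime] (hq : ¬ q ∣ Nminus) :
    Nonempty (ℚ_[q] ⊗[ℚ] QuaternionAlgebra ℚ S.a 0 S.b ≃ₐ[ℚ_[q]] Matrix (Fin 2) (Fin 2) ℚ_[q]) := by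
  have ha : (S.a : ℚ_[q]) ≠ 0 := by exact_mod_cast S.a_neg.ne
  have hb : (S.b : ℚ_[q]) ≠ 0 := by exact_mod_cast S.b_neg.ne
  -- a non-zero non-unit of `ℍ[ℚ_q, a, b]`
  have hndiv : ¬ ∀ x : QuaternionAlgebra ℚ_[q] (S.a : ℚ_[q]) 0 (S.b : ℚ_[q]), x ≠ 0 → IsUnit x :=
    fun h => hq ((S.ramified_iff q).mp h)
  push Not at hndiv
  obtain ⟨x, hx0, hxu⟩ := hndiv
  obtain ⟨u, v, huv⟩ := QuaternionAlgebra.exists_sq_sub_mul_sq_of_not_isUnit ha (q := x) hx0 hxu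
  obtain ⟨e⟩ := (QuaternionAlgebra.nonempty_algEquiv_matrix_iff ha hb).mpr ⟨u, v, huv⟩
  obtain ⟨f⟩ := QuaternionAlgebra.nonempty_baseChange_algEquiv ℚ ℚ_[q] S.a S.b
  have hca : algebraMap ℚ ℚ_[q] S.a = (S.a : ℚ_[q]) := by rw [eq_ratCast]
  have hcb : algebraMap ℚ ℚ_[q] S.b = (S.b : ℚ_[q]) := by rw [eq_ratCast]
  rw [hca, hcb] at f
  exact ⟨f.trans e⟩

/-! ### Residual splitting at the good primes; finiteness of the class set -/

/-- **The Eichler order of a definite set-up is residually split at every prime `q ∤ N⁺N⁻`**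
(verbatim the argument of `XiSetup.isResiduallySplit`: the dichotomy
`IsEichlerOrder.residuallySplit_or_ramified`, and in the ramified branch at most one invertible
sub-ideal of index `q²` (`IsRamifiedData.subsingleton_subideal`) against Eichler's count `q + 1`
(`IsEichlerOrder.natCard_subideals_eq_prime_add_one`, which needs the splitting
`nonempty_algEquiv_padic`)). [cite: VignerasLNM800, Ch. II §2 Thm. 2.3] [cite: Eichler1973, Ch. II §6 (16)] -/
theorem DefiniteSetupLite.isResiduallySplit {Nplus Nminus : ℕ} (S : DefiniteSetupLite Nplus Nminus)
    {p : ℕ} (hp : p.Prime) (hpN : ¬ p ∣ Nplus * Nminus) :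
    S.isEichlerOrder.isZOrder.IsResiduallySplit p := by
  haveI : Fact p.Prime := ⟨hp⟩
  haveI : IsQuaternionAlgebra ℚ (QuaternionAlgebra ℚ S.a 0 S.b) := S.isQuaternionAlgebra
  have hE := S.isEichlerOrder
  have hpNplus : ¬ p ∣ Nplus := fun h => hpN (dvd_mul_of_dvd_left h Nminus)
  have hpNminus : ¬ p ∣ Nminus := fun h => hpN (dvd_mul_of_dvd_right h Nplus)
  rcases hE.residuallySplit_or_ramified hp ((Nat.Prime.coprime_iff_not_dvd hp).mpr hpNplus) with
    hs | hr
  · exact hs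
  · exfalso
    have hdiv := S.forall_isUnit
    have hO : IsZOrder (subringLattice S.O) := hE.isZOrder
    have hI : IsInvertibleRightIdeal (subringLattice S.O) (subringLattice S.O) :=
      hO.isInvertibleRightIdeal_self
    have hcount := hE.natCard_subideals_eq_prime_add_one hdiv hpNplus
      (S.nonempty_algEquiv_padic hpNminus) hI
    obtain ⟨P, hP⟩ := hr.exists_isRamifiedData
    obtain ⟨π, -, hπ, hvπ⟩ := hP.exists_uniformizer hO hp hdiv
    obtain ⟨α, -, hα⟩ := hI.exists_localAt_eq_units_smul hdiv hO p
    have hsub : Subsingleton (Subideal (subringLattice S.O) (subringLattice S.O) (p ^ 1)) :=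
      hP.subsingleton_subideal hO hp hπ hvπ hdiv hα 1
    rw [pow_one] at hsub
    change Nat.card (Subideal (subringLattice S.O) (subringLattice S.O) p) = p + 1 at hcount
    haveI : Finite (Subideal (subringLattice S.O) (subringLattice S.O) p) :=
      Nat.finite_of_card_ne_zero (by rw [hcount]; omega)
    have hle : Nat.card (Subideal (subringLattice S.O) (subringLattice S.O) p) ≤ 1 :=
      Finite.card_le_one_iff_subsingleton.mpr hsub
    have := hp.two_le
    omega

/-- **The class set of the Eichler order of a definite set-up is finite** (Jordan–Zassenhaus /
Vignéras III §5 Thm. 5.4, `RightIdealClass.finite`). [cite: VignerasLNM800, Ch. III §5 Thm. 5.4] -/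
theorem DefiniteSetupLite.finite_rightIdealClass {Nplus Nminus : ℕ}
    (S : DefiniteSetupLite Nplus Nminus) : Finite (RightIdealClass (subringLattice S.O)) := by
  haveI : IsQuaternionAlgebra ℚ (QuaternionAlgebra ℚ S.a 0 S.b) := S.isQuaternionAlgebra
  exact RightIdealClass.finite S.isZOrder

/-! ### Left translates and Hecke neighbours -/

/-- The routes' left translate `I.map (x ↦ β x)` is the tree's `β • I`. [folklore] -/
theorem map_mulLeft_eq_units_smul {B : Type*} [Ring B] (β : Bˣ) (I : Submodule ℤ B) :
    I.map (AddMonoidHom.mulLeft (β : B)).toIntLinearMap = β • I := by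
  ext x
  simp only [Submodule.mem_map, AddMonoidHom.coe_toIntLinearMap, AddMonoidHom.coe_mulLeft,
    Submodule.mem_smul_pointwise_iff_exists, Units.smul_def, smul_eq_mul]

/-- An invertible right `O`-ideal `J ⊆ I` of index `q²` is a Hecke neighbour of `I` (it is
right-`O`-stable). [folklore] -/
theorem mem_heckeNeighboursLite_of_isInvertibleRightIdeal {O : Subring (QuaternionAlgebra ℚ a 0 b)}
    {q : ℕ} {I J : Submodule ℤ (QuaternionAlgebra ℚ a 0 b)}
    (hJ : IsInvertibleRightIdeal (subringLattice O) J) (hJI : J ≤ I)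
    (hidx : J.toAddSubgroup.relIndex I.toAddSubgroup = q ^ 2) : J ∈ heckeNeighboursLite O q I :=
  ⟨hJI, hidx, fun _ hy _ hx => hJ.mul_mem hy (mem_subringLattice.mpr hx)⟩

/-- **Hecke neighbours at a good prime are invertible** — heredity at a residually split prime:
for a prime `q ∤ N⁺N⁻` and an invertible right `S.O`-ideal `I`, every right-`S.O`-stable
sublattice `J ⊆ I` of index `q²` is an invertible right `S.O`-ideal (`q² I ⊆ J ⊆ I`,
`IsMatrixUnitsMod.isInvertibleRightIdeal_of_between`). [cite: VignerasLNM800, Ch. II §2]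
[cite: Voight2021, Main Thm. 16.6.1] -/
theorem DefiniteSetupLite.isInvertibleRightIdeal_of_mem_heckeNeighboursLite {Nplus Nminus : ℕ}
    (S : DefiniteSetupLite Nplus Nminus) {q : ℕ} (hq : q.Prime) (hqN : ¬ q ∣ Nplus * Nminus)
    {I J : Submodule ℤ (QuaternionAlgebra ℚ S.a 0 S.b)}
    (hI : IsInvertibleRightIdeal (subringLattice S.O) I) (hJ : J ∈ heckeNeighboursLite S.O q I) :
    IsInvertibleRightIdeal (subringLattice S.O) J := by
  haveI : IsQuaternionAlgebra ℚ (QuaternionAlgebra ℚ S.a 0 S.b) := S.isQuaternionAlgebra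
  obtain ⟨hJI, hidx, hstab⟩ := hJ
  obtain ⟨e, u, v, hmu⟩ := (S.isResiduallySplit hq hqN).exists_isMatrixUnitsMod
  refine hmu.isInvertibleRightIdeal_of_between S.forall_isUnit S.isZOrder hq hI hJI
    (fun x hx o ho => hstab x hx o (mem_subringLattice.mp ho)) (n := 2) fun x hx => ?_
  have h := zsmul_relIndex_mem (M := J) (I := I) hx
  rwa [hidx] at h

/-- **The Hecke neighbours of an invertible right ideal at a good prime are its invertible
sub-ideals of index `q²`**: for a prime `q ∤ N⁺N⁻` and `I ∈ rightIdealsLite S.O`,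
`J ∈ heckeNeighboursLite S.O q I ↔ J ∈ rightIdealsLite S.O ∧ J ⊆ I ∧ [I : J] = q²` — the index set
of the inline eigen-equations is the tree's `Subideal (subringLattice S.O) I q`.
[cite: Voight2021, (41.1.1)] [cite: Eichler1973, Ch. II §6 (14)–(15)] -/
theorem DefiniteSetupLite.mem_heckeNeighboursLite_iff {Nplus Nminus : ℕ}
    (S : DefiniteSetupLite Nplus Nminus) {q : ℕ} (hq : q.Prime) (hqN : ¬ q ∣ Nplus * Nminus)
    {I : Submodule ℤ (QuaternionAlgebra ℚ S.a 0 S.b)} (hI : I ∈ rightIdealsLite S.O)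
    (J : Submodule ℤ (QuaternionAlgebra ℚ S.a 0 S.b)) :
    J ∈ heckeNeighboursLite S.O q I ↔
      J ∈ rightIdealsLite S.O ∧ J ≤ I ∧ J.toAddSubgroup.relIndex I.toAddSubgroup = q ^ 2 := by
  rw [mem_rightIdealsLite_iff_isInvertibleRightIdeal] at hI ⊢
  constructor
  · intro hJ
    exact ⟨S.isInvertibleRightIdeal_of_mem_heckeNeighboursLite hq hqN hI hJ, hJ.1, hJ.2.1⟩
  · rintro ⟨hJ, hJI, hidx⟩
    exact mem_heckeNeighboursLite_of_isInvertibleRightIdeal hJ hJI hidx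

end Brandt

end Literature.NumberTheory.Automorphic

end
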